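import Mathlib.CategoryTheory.Comma.Over.Pullback
import Mathlib.CategoryTheory.Limits.Shapes.Pullback.HasPullback
import Mathlib.CategoryTheory.Limits.Preserves.Shapes.Equalizers
import HarnessLib

/-!
# Rigidity of functors out of `C_{/A}` that are known on `A × (−)` ([SemiAnbd] Def. 2.2 (i), p. 23)

Mochizuki, *Semi-graphs of anabelioids*, Publ. RIMS **42** (2006), §2, Def. 2.2 (i) and the paragraph
before it, author's manuscript p. 23 [cite: MochizukiSemiAnbd2006, Def. 2.2(i) p.23]: the finite étale
covering attached to an object `A` of `B(𝒢)` is read through `B(𝒢)_{/A}` and the functor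
`A × (−) : B(𝒢) → B(𝒢)_{/A}` (right adjoint of the forgetful functor).  In the cell's covering notion
(`Hom.IsGlobalCoveringOf`, `Hom.IsFiniteEtaleCoveringOf`) a covering comes with an equivalence
`α : B(𝒢)_{/A} ⥲ B(𝒢′)` and an isomorphism `φ^* ≅ (A × −) ⋙ α` — so `α` is pinned only on the image of
`Over.star A`.  This file records how much such data determine.

PURE CATEGORY THEORY over Mathlib, infrastructure for F-1478 (abc-iut cell, layer L3: residual
«print's finite étale coverings compose», sub-brick (L-K) of the LOCAL clause of a composite covering;
seat abc-iut-w5-d041; memo `HOME/staging/w5/w5-d041-g3/L-LOCAL-CLAUSE-DECOMPOSITION.md`).  We work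
with an ARBITRARY right adjoint `S` of `Over.forget A` (`adj : Over.forget A ⊣ S`; the case of record is
`S = Over.star A`, `adj = Over.forgetAdjStar A`):

* `OverStar.graphForkIsLimit` — every object `Y → A` of `C_{/A}` is the EQUALIZER of `S(Y.hom)` and the
  "diagonal" `S(Y.left) ⟶ S((A × Y.left)) ⟶ S(A)`, the equalizer inclusion being the unit
  `Y ⟶ S(Y.left)` (the graph of `Y.hom`);
* `OverStar.pullbackForkIsLimit` — for `σ : P ⟶ A′`, `g : Y′ ⟶ A′` the pull-back `P ×_{A′} Y′ → P` is the
  equalizer in `C′_{/P}` of `S′(g)` and the `σ`-twisted diagonal;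
* `OverStar.sectionMap`, `OverStar.isoPullback` — hence a functor `K : C_{/A} ⥤ C′_{/P}` preserving
  equalizers, with `K(𝟙_A)` terminal and an isomorphism `S ⋙ K ≅ R ⋙ S′`, is OBJECTWISE BASE CHANGE
  along its SECTION MAP `σ_K : P ⟶ R(A)` (the transpose of `K` applied to the diagonal `𝟙_A ⟶ S(A)`):
  `K(Y) ≅ P ×_{σ_K, R A} R(Y.left)` over `P`, compatibly with the structure maps to `S′(R(Y.left))`
  (`isoPullback_hom_comp`).

Consumers: the comparison `α_w⁻¹ ∘ ρ_w ∘ α_ψ` between the GLOBAL and the LOCAL witnesses of a covering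
(the local clause of a composite), and the `Aut(A)`-torsor structure of the global witness.  No cell
definition is touched; no `Prop` is asserted; nothing here bears on [IUTchIII] Cor. 3.12.
-/

namespace Literature.AnabelianGeometry.SemiGraphs

open CategoryTheory CategoryTheory.Limits

universe v u v' u'

namespace OverStar

variable {C : Type u} [Category.{v} C] {A : C} {S : C ⥤ Over A} (adj : Over.forget A ⊣ S)

/-! ### Transposes along `forget ⊣ S`, with clean types -/

/-- The unit `Z ⟶ S(Z.left)` of `forget ⊣ S` (for `S = A × (−)`: the graph `z ↦ (p(z), z)`).
[cite: MochizukiSemiAnbd2006, Def. 2.2(i) p.23] -/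
def unit' (Z : Over A) : Z ⟶ S.obj Z.left := adj.unit.app Z

/-- `unit'` is the unit of the adjunction. [cite: MochizukiSemiAnbd2006, Def. 2.2(i) p.23] -/
theorem unit'_eq (Z : Over A) : unit' adj Z = adj.unit.app Z := rfl

/-- The counit `S(X).left ⟶ X` of `forget ⊣ S` (for `S = A × (−)`: the second projection).
[cite: MochizukiSemiAnbd2006, Def. 2.2(i) p.23] -/
def counit' (X : C) : (S.obj X).left ⟶ X := adj.counit.app X

/-- `counit'` is the counit of the adjunction. [cite: MochizukiSemiAnbd2006, Def. 2.2(i) p.23] -/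
theorem counit'_eq (X : C) : counit' adj X = adj.counit.app X := rfl

/-- The transpose `Z.left ⟶ X` of `t : Z ⟶ S(X)`: `t.left` followed by the counit.
[cite: MochizukiSemiAnbd2006, Def. 2.2(i) p.23] -/
def tr {Z : Over A} {X : C} (t : Z ⟶ S.obj X) : Z.left ⟶ X := t.left ≫ counit' adj X

/-- A morphism into `S(X)` is recovered from its transpose. [cite: MochizukiSemiAnbd2006, Def. 2.2(i) p.23] -/
theorem eq_unit_comp_map_tr {Z : Over A} {X : C} (t : Z ⟶ S.obj X) :
    t = unit' adj Z ≫ S.map (tr adj t) := by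
  have h := ((adj.homEquiv Z X).apply_symm_apply t).symm
  rw [Adjunction.homEquiv_unit, Adjunction.homEquiv_counit] at h
  exact h

/-- Transposition is injective. [cite: MochizukiSemiAnbd2006, Def. 2.2(i) p.23] -/
theorem tr_injective {Z : Over A} {X : C} {t t' : Z ⟶ S.obj X} (h : tr adj t = tr adj t') :
    t = t' := by
  rw [eq_unit_comp_map_tr adj t, eq_unit_comp_map_tr adj t', h]

/-- Transpose of the unit: the identity. [cite: MochizukiSemiAnbd2006, Def. 2.2(i) p.23] -/
theorem tr_unit (Z : Over A) : tr adj (unit' adj Z) = 𝟙 Z.left :=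
  adj.left_triangle_components Z

/-- Naturality of the counit, with clean types. [cite: MochizukiSemiAnbd2006, Def. 2.2(i) p.23] -/
theorem map_left_comp_counit' {X X' : C} (g : X ⟶ X') :
    (S.map g).left ≫ counit' adj X' = counit' adj X ≫ g :=
  adj.counit.naturality g

/-- Transposes are natural in the target. [cite: MochizukiSemiAnbd2006, Def. 2.2(i) p.23] -/
theorem tr_comp_map {Z : Over A} {X X' : C} (t : Z ⟶ S.obj X) (g : X ⟶ X') :
    tr adj (t ≫ S.map g) = tr adj t ≫ g := by
  simp only [tr, Over.comp_left, Category.assoc, map_left_comp_counit']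

/-- Transposes are natural in the source. [cite: MochizukiSemiAnbd2006, Def. 2.2(i) p.23] -/
theorem tr_precomp {Z Z' : Over A} {X : C} (m : Z' ⟶ Z) (t : Z ⟶ S.obj X) :
    tr adj (m ≫ t) = m.left ≫ tr adj t := by
  simp only [tr, Over.comp_left, Category.assoc]

/-! ### The graph–equalizer presentation of an object of `C_{/A}` -/

/-- The "diagonal" `S(X) ⟶ S(A)` of `C_{/A}`: the unit at `S(X)` followed by `S` of the structure map
of `S(X)` (for `S = A × (−)`: `(a, x) ↦ (a, (a, x)) ↦ (a, a)`). [cite: MochizukiSemiAnbd2006, Def. 2.2(i) p.23] -/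
def diag (X : C) : S.obj X ⟶ S.obj A := unit' adj (S.obj X) ≫ S.map (S.obj X).hom

/-- Transpose of the diagonal: the structure morphism of `S(X)`. [cite: MochizukiSemiAnbd2006, Def. 2.2(i) p.23] -/
theorem tr_diag (X : C) : tr adj (diag adj X) = (S.obj X).hom := by
  rw [diag, tr_comp_map, tr_unit, Category.id_comp]

/-- Transpose of `t ≫ diag`: the structure morphism of the source.
[cite: MochizukiSemiAnbd2006, Def. 2.2(i) p.23] -/
theorem tr_comp_diag {Z : Over A} {X : C} (t : Z ⟶ S.obj X) : tr adj (t ≫ diag adj X) = Z.hom := by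
  rw [tr_precomp, tr_diag]
  exact Over.w t

/-- The unit `Y ⟶ S(Y.left)` (the graph of `Y.hom`) equalizes `S(Y.hom)` and the diagonal.
[cite: MochizukiSemiAnbd2006, Def. 2.2(i) p.23] -/
theorem graph_condition (Y : Over A) :
    unit' adj Y ≫ S.map Y.hom = unit' adj Y ≫ diag adj Y.left := by
  apply tr_injective adj
  rw [tr_comp_map, tr_comp_diag, tr_unit, Category.id_comp]

/-- Transpose of `m ≫ unit`: the underlying morphism of `m`. [cite: MochizukiSemiAnbd2006, Def. 2.2(i) p.23] -/
theorem tr_comp_unit {Z : Over A} (Y : Over A) (m : Z ⟶ Y) : tr adj (m ≫ unit' adj Y) = m.left := by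
  rw [tr_precomp, tr_unit, Category.comp_id]

/-- The lift of a fork over `S(Y.hom)`, diagonal through the graph of `Y`: its transpose, as a
morphism over `A`. [cite: MochizukiSemiAnbd2006, Def. 2.2(i) p.23] -/
def graphLift (Y : Over A) (s : Fork (S.map Y.hom) (diag adj Y.left)) : s.pt ⟶ Y :=
  Over.homMk (tr adj s.ι) (by
    have h := congrArg (tr adj) s.condition
    rw [tr_comp_map, tr_comp_diag] at h
    exact h)

/-- **Graph–equalizer presentation**: every `Y ∈ C_{/A}` is the equalizer of `S(Y.hom)` and the
diagonal, via the unit of `forget ⊣ S`. [cite: MochizukiSemiAnbd2006, Def. 2.2(i) p.23] -/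
noncomputable def graphForkIsLimit (Y : Over A) :
    IsLimit (Fork.ofι (unit' adj Y) (graph_condition adj Y)) :=
  Fork.IsLimit.mk _ (graphLift adj Y)
    (fun s => by
      apply tr_injective adj
      exact tr_comp_unit adj Y (graphLift adj Y s))
    (fun s m hm => by
      ext
      exact (tr_comp_unit adj Y m).symm.trans (congrArg (tr adj) hm))

/-! ### Pull-backs as equalizers in `C′_{/P}` -/

section Pullback

variable {C' : Type u'} [Category.{v'} C'] {P : C'} {S' : C' ⥤ Over P} (adj' : Over.forget P ⊣ S')

/-- The `σ`-TWISTED diagonal `S′(X′) ⟶ S′(A′)` determined by `σ : P ⟶ A′` (for `S′ = P × (−)`: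
`(p, x) ↦ (p, σ p)`). [cite: MochizukiSemiAnbd2006, Def. 2.2(i) p.23] -/
def twistedDiag {A' : C'} (σ : P ⟶ A') (X' : C') : S'.obj X' ⟶ S'.obj A' :=
  unit' adj' (S'.obj X') ≫ S'.map ((S'.obj X').hom ≫ σ)

/-- Transpose of the twisted diagonal: `(S′ X′).hom ≫ σ`. [cite: MochizukiSemiAnbd2006, Def. 2.2(i) p.23] -/
theorem tr_twistedDiag {A' : C'} (σ : P ⟶ A') (X' : C') :
    tr adj' (twistedDiag adj' σ X') = (S'.obj X').hom ≫ σ := by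
  rw [twistedDiag, tr_comp_map, tr_unit, Category.id_comp]

/-- Transpose of `t ≫ twistedDiag σ`: `Z.hom ≫ σ`. [cite: MochizukiSemiAnbd2006, Def. 2.2(i) p.23] -/
theorem tr_comp_twistedDiag {A' : C'} (σ : P ⟶ A') {Z : Over P} {X' : C'} (t : Z ⟶ S'.obj X') :
    tr adj' (t ≫ twistedDiag adj' σ X') = Z.hom ≫ σ := by
  rw [tr_precomp, tr_twistedDiag, ← Category.assoc, Over.w t]

variable [HasPullbacks C'] {A' Y' : C'} (σ : P ⟶ A') (g : Y' ⟶ A')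

/-- The pull-back `P ×_{A′} Y′ → P` along `σ`, as an object of `C′_{/P}`.
[cite: MochizukiSemiAnbd2006, Def. 2.2(i) p.23] -/
noncomputable abbrev pullbackObj : Over P := Over.mk (pullback.fst σ g)

/-- Its structure map into `S′(Y′)`: the morphism whose transpose is the second projection.
[cite: MochizukiSemiAnbd2006, Def. 2.2(i) p.23] -/
noncomputable def pullbackι : pullbackObj σ g ⟶ S'.obj Y' :=
  unit' adj' (pullbackObj σ g) ≫ S'.map (pullback.snd σ g)

/-- The transpose of `pullbackι` is the second projection. [cite: MochizukiSemiAnbd2006, Def. 2.2(i) p.23] -/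
theorem tr_pullbackι : tr adj' (pullbackι adj' σ g) = pullback.snd σ g := by
  rw [pullbackι, tr_comp_map, tr_unit, Category.id_comp]

/-- Transpose of `m ≫ pullbackι`: `m.left` followed by the second projection.
[cite: MochizukiSemiAnbd2006, Def. 2.2(i) p.23] -/
theorem tr_comp_pullbackι {Z : Over P} (m : Z ⟶ pullbackObj σ g) :
    tr adj' (m ≫ pullbackι adj' σ g) = m.left ≫ pullback.snd σ g := by
  rw [tr_precomp, tr_pullbackι]

/-- The pull-back equalizes `S′(g)` and the twisted diagonal. [cite: MochizukiSemiAnbd2006, Def. 2.2(i) p.23] -/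
theorem pullback_condition :
    pullbackι adj' σ g ≫ S'.map g = pullbackι adj' σ g ≫ twistedDiag adj' σ Y' := by
  apply tr_injective adj'
  rw [tr_comp_map, tr_comp_twistedDiag, tr_pullbackι]
  exact (pullback.condition).symm

/-- The lift of a fork over `S′(g)`, twisted diagonal through the pull-back: the pull-back pairing of
the structure morphism and the transpose. [cite: MochizukiSemiAnbd2006, Def. 2.2(i) p.23] -/
noncomputable def pullbackLift (s : Fork (S'.map g) (twistedDiag adj' σ Y')) :
    s.pt ⟶ pullbackObj σ g :=
  Over.homMk (pullback.lift s.pt.hom (tr adj' s.ι) (by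
      have h := congrArg (tr adj') s.condition
      rw [tr_comp_map, tr_comp_twistedDiag] at h
      exact h.symm))
    (pullback.lift_fst _ _ _)

/-- **Pull-back as an equalizer over `P`**: `P ×_{A′} Y′ → P` is the equalizer in `C′_{/P}` of `S′(g)`
and the twisted diagonal. [cite: MochizukiSemiAnbd2006, Def. 2.2(i) p.23] -/
noncomputable def pullbackForkIsLimit :
    IsLimit (Fork.ofι (pullbackι adj' σ g) (pullback_condition adj' σ g)) :=
  Fork.IsLimit.mk _ (pullbackLift adj' σ g)
    (fun s => by
      apply tr_injective adj'
      exact (tr_comp_pullbackι adj' σ g (pullbackLift adj' σ g s)).trans (pullback.lift_snd _ _ _))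
    (fun s m hm => by
      ext
      have h : m.left ≫ pullback.snd σ g = tr adj' s.ι :=
        (tr_comp_pullbackι adj' σ g m).symm.trans (congrArg (tr adj') hm)
      apply pullback.hom_ext
      · exact (Over.w m).trans (pullback.lift_fst _ _ _).symm
      · exact h.trans (pullback.lift_snd _ _ _).symm)

end Pullback

/-! ### Functors out of `C_{/A}` known on the right adjoint are base change along their section map -/

section Rigidity

variable {C' : Type u'} [Category.{v'} C'] {P : C'} {S' : C' ⥤ Over P}
  (adj' : Over.forget P ⊣ S') (K : Over A ⥤ Over P) (R : C ⥤ C') (ι : S ⋙ K ≅ R ⋙ S')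
  (hT : IsTerminal (K.obj (Over.mk (𝟙 A))))

/-- The component of `ι` at `X`, with clean types `K(S X) ≅ S′(R X)`.
[cite: MochizukiSemiAnbd2006, Def. 2.2(i) p.23] -/
def ιIso (X : C) : K.obj (S.obj X) ≅ S'.obj (R.obj X) := ι.app X

/-- The component of `ι.hom` at `X`, with clean types. [cite: MochizukiSemiAnbd2006, Def. 2.2(i) p.23] -/
def ιHom (X : C) : K.obj (S.obj X) ⟶ S'.obj (R.obj X) := ι.hom.app X

/-- `ιHom` is the component of `ι.hom`. [cite: MochizukiSemiAnbd2006, Def. 2.2(i) p.23] -/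
theorem ιHom_eq (X : C) : ιHom K R ι X = ι.hom.app X := rfl

/-- `(ιIso X).hom = ιHom X`. [cite: MochizukiSemiAnbd2006, Def. 2.2(i) p.23] -/
@[simp] theorem ιIso_hom (X : C) : (ιIso K R ι X).hom = ιHom K R ι X := rfl

/-- Naturality of `ι`, with clean types. [cite: MochizukiSemiAnbd2006, Def. 2.2(i) p.23] -/
theorem ιHom_naturality {X X' : C} (f : X ⟶ X') :
    K.map (S.map f) ≫ ιHom K R ι X' = ιHom K R ι X ≫ S'.map (R.map f) :=
  ι.hom.naturality f

/-- The diagonal at the terminal object `𝟙_A`: `𝟙_A ⟶ S(A)` (for `S = A × (−)`: `a ↦ (a, a)`).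
[cite: MochizukiSemiAnbd2006, Def. 2.2(i) p.23] -/
def diagTop : Over.mk (𝟙 A) ⟶ S.obj A :=
  unit' adj (Over.mk (𝟙 A)) ≫ S.map (Over.mk (𝟙 A)).hom

/-- The diagonal of `S(X)` factors through the terminal object: `S(X) ⟶ 𝟙_A ⟶ S(A)`.
[cite: MochizukiSemiAnbd2006, Def. 2.2(i) p.23] -/
theorem diag_eq_from_comp_diagTop (X : C) :
    diag adj X = Over.mkIdTerminal.from (S.obj X) ≫ diagTop adj := by
  apply tr_injective adj
  rw [tr_diag, diagTop, ← Category.assoc, tr_comp_map, tr_precomp, tr_unit, Category.comp_id,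
    Over.mkIdTerminal_from_left]
  exact (Category.comp_id _).symm

/-- The SECTION of `K`: `K` of the diagonal `𝟙_A ⟶ S(A)`, read as a morphism `𝟙_P ⟶ S′(R A)` through
the terminality of `K(𝟙_A)` and `ι`. [cite: MochizukiSemiAnbd2006, Def. 2.2(i) p.23] -/
noncomputable def section_ : Over.mk (𝟙 P) ⟶ S'.obj (R.obj A) :=
  hT.from (Over.mk (𝟙 P)) ≫ K.map (diagTop adj) ≫ ιHom K R ι A

/-- The SECTION MAP `σ_K : P ⟶ R(A)` of `K`: the transpose of its section ("where `K` sends the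
tautological point"). [cite: MochizukiSemiAnbd2006, Def. 2.2(i) p.23] -/
noncomputable def sectionMap : P ⟶ R.obj A := tr adj' (section_ adj K R ι hT)

/-- `K` carries the diagonal of `C_{/A}` to the twisted diagonal of `C′_{/P}` along its section map,
through `ι`. [cite: MochizukiSemiAnbd2006, Def. 2.2(i) p.23] -/
theorem map_diag (X : C) :
    K.map (diag adj X) ≫ ιHom K R ι A =
      ιHom K R ι X ≫ twistedDiag adj' (sectionMap adj adj' K R ι hT) (R.obj X) := by
  have h1 : K.map (Over.mkIdTerminal.from (S.obj X)) =
      ιHom K R ι X ≫ Over.mkIdTerminal.from (S'.obj (R.obj X)) ≫ hT.from (Over.mk (𝟙 P)) :=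
    hT.hom_ext _ _
  have h2 : Over.mkIdTerminal.from (S'.obj (R.obj X)) ≫ section_ adj K R ι hT =
      twistedDiag adj' (sectionMap adj adj' K R ι hT) (R.obj X) := by
    apply tr_injective adj'
    rw [tr_precomp, tr_twistedDiag, Over.mkIdTerminal_from_left]
    rfl
  rw [diag_eq_from_comp_diagTop, K.map_comp_assoc, h1, ← h2, section_]
  simp only [Category.assoc]

/-- The two parallel pairs `K(S(Y.hom)), K(diag)` and `S′(R(Y.hom)), twisted diagonal` are isomorphic
through `ι`. [cite: MochizukiSemiAnbd2006, Def. 2.2(i) p.23] -/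
noncomputable def pairIso (Y : Over A) :
    parallelPair (K.map (S.map Y.hom)) (K.map (diag adj Y.left)) ≅
      parallelPair (S'.map (R.map Y.hom))
        (twistedDiag adj' (sectionMap adj adj' K R ι hT) (R.obj Y.left)) :=
  parallelPair.ext (ιIso K R ι Y.left) (ιIso K R ι A)
    (by simpa using ιHom_naturality K R ι Y.hom)
    (by simpa using map_diag adj adj' K R ι hT Y.left)

variable [HasPullbacks C']

/-- **Rigidity**: a functor `K : C_{/A} ⥤ C′_{/P}` preserving equalizers, with `K(𝟙_A)` terminal and
`S ⋙ K ≅ R ⋙ S′`, is objectwise base change along its section map: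
`K(Y) ≅ P ×_{σ_K, R A} R(Y.left)` over `P`. [cite: MochizukiSemiAnbd2006, Def. 2.2(i) p.23] -/
noncomputable def isoPullback [PreservesLimitsOfShape WalkingParallelPair K] (Y : Over A) :
    K.obj Y ≅ pullbackObj (sectionMap adj adj' K R ι hT) (R.map Y.hom) :=
  IsLimit.conePointUniqueUpToIso
    ((IsLimit.postcomposeHomEquiv (pairIso adj adj' K R ι hT Y) _).symm
      (isLimitForkMapOfIsLimit K (graph_condition adj Y) (graphForkIsLimit adj Y)))
    (pullbackForkIsLimit adj' (sectionMap adj adj' K R ι hT) (R.map Y.hom))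

/-- Compatibility of the rigidity isomorphism with the structure maps: it carries `K` of the graph
`Y ⟶ S(Y.left)` (followed by `ι`) to the map `P ×_{R A} R(Y.left) ⟶ S′(R(Y.left))` whose transpose is
the second projection. [cite: MochizukiSemiAnbd2006, Def. 2.2(i) p.23] -/
theorem isoPullback_hom_comp [PreservesLimitsOfShape WalkingParallelPair K] (Y : Over A) :
    (isoPullback adj adj' K R ι hT Y).hom ≫
        pullbackι adj' (sectionMap adj adj' K R ι hT) (R.map Y.hom) =
      K.map (unit' adj Y) ≫ ιHom K R ι Y.left := by
  have h := IsLimit.conePointUniqueUpToIso_hom_comp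
    ((IsLimit.postcomposeHomEquiv (pairIso adj adj' K R ι hT Y) _).symm
      (isLimitForkMapOfIsLimit K (graph_condition adj Y) (graphForkIsLimit adj Y)))
    (pullbackForkIsLimit adj' (sectionMap adj adj' K R ι hT) (R.map Y.hom)) WalkingParallelPair.zero
  simp only [Cone.postcompose_obj_π, NatTrans.comp_app, Fork.app_zero_eq_ι, Fork.ι_ofι, pairIso,
    parallelPair.ext_hom_app, ιIso_hom] at h
  exact h

/-- **Rigidity, existential form** (what the covering dictionary consumes).
[cite: MochizukiSemiAnbd2006, Def. 2.2(i) p.23] -/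
theorem exists_iso_pullback [PreservesLimitsOfShape WalkingParallelPair K] (Y : Over A) :
    ∃ e : K.obj Y ≅ pullbackObj (sectionMap adj adj' K R ι hT) (R.map Y.hom),
      e.hom ≫ pullbackι adj' (sectionMap adj adj' K R ι hT) (R.map Y.hom) =
        K.map (unit' adj Y) ≫ ιHom K R ι Y.left :=
  ⟨isoPullback adj adj' K R ι hT Y, isoPullback_hom_comp adj adj' K R ι hT Y⟩

end Rigidity

/-! ### The case of record: `S = A × (−)` (`Over.star`) -/

section Star

variable [HasBinaryProducts C] {C' : Type u'} [Category.{v'} C'] [HasBinaryProducts C']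
  [HasPullbacks C'] {P : C'} (K : Over A ⥤ Over P) (R : C ⥤ C')
  (ι : Over.star A ⋙ K ≅ R ⋙ Over.star P) (hT : IsTerminal (K.obj (Over.mk (𝟙 A))))
  [PreservesLimitsOfShape WalkingParallelPair K]

/-- **Rigidity for `A × (−)`** ([SemiAnbd] Def. 2.2 (i): the covering data `B(𝒢)_{/A}`, `A × (−)`):
a functor `K : C_{/A} ⥤ C′_{/P}` preserving equalizers, with `K(𝟙_A)` terminal and
`Over.star A ⋙ K ≅ R ⋙ Over.star P`, satisfies `K(Y) ≅ P ×_{σ_K, R A} R(Y.left)` over `P` for every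
`Y`, `σ_K = sectionMap (Over.forgetAdjStar A) (Over.forgetAdjStar P) K R ι hT : P ⟶ R A`, compatibly
with the structure maps. [cite: MochizukiSemiAnbd2006, Def. 2.2(i) p.23] -/
theorem exists_iso_pullback_star (Y : Over A) :
    ∃ e : K.obj Y ≅
        pullbackObj (sectionMap (Over.forgetAdjStar A) (Over.forgetAdjStar P) K R ι hT) (R.map Y.hom),
      e.hom ≫ pullbackι (Over.forgetAdjStar P)
          (sectionMap (Over.forgetAdjStar A) (Over.forgetAdjStar P) K R ι hT) (R.map Y.hom) =
        K.map (unit' (Over.forgetAdjStar A) Y) ≫ ιHom K R ι Y.left :=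
  exists_iso_pullback (Over.forgetAdjStar A) (Over.forgetAdjStar P) K R ι hT Y

end Star

end OverStar

end Literature.AnabelianGeometry.SemiGraphs
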